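import Summits.KontsevichZagierPeriods.Zeta5Search.Certificates.RayC5KernelBase
import Summits.KontsevichZagierPeriods.Zeta5Search.Denom.DigitCert
import Summits.KontsevichZagierPeriods.Zeta5Search.Denom.DualSeriesBrickOrd
import HarnessLib

/-!
# ζ(5) search — certificates: the brick exponent `ν` on the ray RayC5 as a floor sum `N(n/p, i/p)` (TYPER g16)

HONEST FRAMING: systematic search; no irrationality claim unless certified.  Integer bookkeeping of floors; nothing about `ζ(5)`.

OUR work (Summit side; typer seat, generation 16; generator `HOME/pub-zeta5-typer-g16/gen/gen_kernelnu.py C5`; the pattern is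
fam-denom g11's `Denom.RecordRayNu` for the record ray, whose ONE checker `Denom.DigitCert` and generic brick exponent
`Denom.DualSeriesBrickOrd.nuPair` (fam-denom 62) are consumed BY NAME).  On the ray `b = n·(51; 21, 19, 18, 16, 15, 13, 12)`:
* `c5Terms` — the 24 floor terms `coef·⌊c_y y + c_x x⌋` of `ν(b; i, p)` (Zudilin's (8.9) for the pair grouping (35));
* `nuPair_bC5_eq` — `ν(b; i, p) = N(n/p, i/p)`; `N` is doubly 1-periodic (`evalC5_add_int_left/right`), so
  `ν = N(n/p − m, fract(i/p))` (`nuPair_bC5_eq_fract`);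
* `nu_ge_of_checked_cell_c5` — a cell `C` with `Cell.check c5Terms C = true` and `a₀/b₀ < n/p − m < a₁/b₁` gives `C.c ≤ ν(b;i,p)`
  for EVERY `i` (`DigitCert.Cell.check_sound`);
* `nuPair_bC5'_ge` — the partner `b′ = b + e₇` has `ν(b′;i,p) ≥ ν(b;i,p)` whenever `p ∤ 18n`, `p ∤ 20n` (the two pair blocks through slot 7).
-/

noncomputable section

open Finset

namespace Summit.KontsevichZagierPeriods.Zeta5Search.RayC5

open Summit.KontsevichZagierPeriods.Zeta5Search.DualSeries
open Summit.KontsevichZagierPeriods.Zeta5Search.DualSeriesDenominators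
open Summit.KontsevichZagierPeriods.Zeta5Search.DualSeriesBounds (natB natB_zero natB_succ)
open Summit.KontsevichZagierPeriods.Zeta5Search.RayKernel
open Summit.KontsevichZagierPeriods.Zeta5Search.Denom.DigitCert
open Summit.KontsevichZagierPeriods.Zeta5Search.Denom.DualSeriesBrickOrd (nuPair)

/-! ### The 24 floor terms of `ν` on the ray -/

/-- The floor terms of `N(x,y)` as `coef·⌊c_y·y + c_x·x⌋`: `⌊y − a x⌋ = (1, −a)`, `⌊a x − y⌋ = (−1, a)`, `⌊a x⌋ = (0, a)`. -/
def c5Terms : List Term :=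
  [⟨1, 1, 0⟩, ⟨-1, 1, -18⟩, ⟨-1, 0, 18⟩,
   ⟨1, -1, 51⟩, ⟨-1, -1, 32⟩, ⟨-1, 0, 19⟩,
   ⟨1, 0, 17⟩, ⟨-1, 1, -21⟩, ⟨-1, -1, 38⟩,
   ⟨1, 0, 18⟩, ⟨-1, 1, -12⟩, ⟨-1, -1, 30⟩,
   ⟨1, 0, 20⟩, ⟨-1, 1, -19⟩, ⟨-1, -1, 39⟩,
   ⟨1, 0, 22⟩, ⟨-1, 1, -13⟩, ⟨-1, -1, 35⟩,
   ⟨1, 0, 20⟩, ⟨-1, 1, -16⟩, ⟨-1, -1, 36⟩,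
   ⟨1, 0, 18⟩, ⟨-1, 1, -15⟩, ⟨-1, -1, 33⟩]

/-- `N(x, y)` of the ray. -/
abbrev evalC5 (x y : ℚ) : ℤ := evalTerms c5Terms x y

/-- `⌊c_y·(i/p) + c_x·(n/p)⌋ = (c_y i + c_x n) / p` (integer division). -/
private theorem fl_gen' (n i p : ℕ) (cy cx : ℤ) :
    ⌊(cy : ℚ) * ((i : ℚ) / p) + (cx : ℚ) * ((n : ℚ) / p)⌋ = (cy * (i : ℤ) + cx * n) / (p : ℤ) := by
  rw [← Rat.floor_intCast_div_natCast]; congr 1; push_cast; ring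

/-- The slots of `b` as natural numbers. -/
theorem bn_bC5_all (n : ℕ) : bn (bC5 n) 0 = 51 * n ∧ bn (bC5 n) 1 = 21 * n ∧ bn (bC5 n) 2 = 19 * n ∧ bn (bC5 n) 3 = 18 * n ∧ bn (bC5 n) 4 = 16 * n ∧ bn (bC5 n) 5 = 15 * n ∧ bn (bC5 n) 6 = 13 * n ∧ bn (bC5 n) 7 = 12 * n := by
  refine ⟨bn_bC5_zero n, ?_, ?_, ?_, ?_, ?_, ?_, ?_⟩
  all_goals rw [show bC5 n = natB (51 * n) (BC5E 0 n) from rfl, bn_natB_succ _ _ (by norm_num)]; simp [BC5E, βC5]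

/-- The slots of `b′` as natural numbers. -/
theorem bn_bC5'_all (n : ℕ) : bn (bC5' n) 0 = 51 * n ∧ bn (bC5' n) 1 = 21 * n ∧ bn (bC5' n) 2 = 19 * n ∧ bn (bC5' n) 3 = 18 * n ∧ bn (bC5' n) 4 = 16 * n ∧ bn (bC5' n) 5 = 15 * n ∧ bn (bC5' n) 6 = 13 * n ∧ bn (bC5' n) 7 = 12 * n + 1 := by
  refine ⟨by rw [bn0_bC5', bn_bC5_zero], ?_, ?_, ?_, ?_, ?_, ?_, ?_⟩
  all_goals rw [show bC5' n = natB (51 * n) (BC5E 1 n) from rfl, bn_natB_succ _ _ (by norm_num)]; simp [BC5E, βC5]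

/-- **`ν(b; i, p) = N(n/p, i/p)`.** -/
theorem nuPair_bC5_eq (n i p : ℕ) : nuPair (bC5 n) i p = evalC5 ((n : ℚ) / p) ((i : ℚ) / p) := by
  obtain ⟨h0, h1, h2, h3, h4, h5, h6, h7⟩ := bn_bC5_all n
  simp only [evalC5, evalTerms, c5Terms, List.map_cons, List.map_nil, List.sum_cons, List.sum_nil, Term.eval,
    fl_gen']
  unfold nuPair
  simp only [sum_range_succ, sum_range_zero, pfst, psnd, h0, h1, h2, h3, h4, h5, h6, h7]
  push_cast
  ring_nf

/-! ### Periodicity -/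

/-- `Σ coef·c_y = 0` over `c5Terms`. -/
theorem c5Terms_sum_cy : (c5Terms.map fun T => T.coef * T.cy).sum = 0 := by rfl

/-- `Σ coef·c_x = 0` over `c5Terms`. -/
theorem c5Terms_sum_cx : (c5Terms.map fun T => T.coef * T.cx).sum = 0 := by rfl

/-- `N(x, y + m) = N(x, y)`. -/
theorem evalC5_add_int_right (x y : ℚ) (m : ℤ) : evalC5 x (y + m) = evalC5 x y := by
  rw [evalC5, evalTerms_add_int_y, c5Terms_sum_cy]; simp

/-- `N(x + m, y) = N(x, y)`. -/
theorem evalC5_add_int_left (x y : ℚ) (m : ℤ) : evalC5 (x + m) y = evalC5 x y := by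
  rw [evalC5, evalTerms_add_int_x, c5Terms_sum_cx]; simp

/-- `ν(b; i, p) = N(n/p − m, y′)` with `y′ = fract(i/p) ∈ [0,1)`. -/
theorem nuPair_bC5_eq_fract (n i p : ℕ) (m : ℤ) :
    nuPair (bC5 n) i p = evalC5 ((n : ℚ) / p - m) (Int.fract ((i : ℚ) / p)) := by
  rw [nuPair_bC5_eq, ← Int.fract_add_floor ((i : ℚ) / p), evalC5_add_int_right, Int.fract_add_floor,
    show (n : ℚ) / p = (n : ℚ) / p - m + (m : ℤ) by ring, evalC5_add_int_left]
  congr 1; ring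

/-! ### The window lemma for a checked cell -/

/-- **Checked cell ⇒ brick exponent.**  If `Cell.check c5Terms C = true` and the prime (any `p > 0`) satisfies
`a₀/b₀ < n/p − m < a₁/b₁` (cross-multiplied), then `C.c ≤ ν(b; i, p)` for EVERY `i`. -/
theorem nu_ge_of_checked_cell_c5 {C : Cell} (hcheck : Cell.check c5Terms C = true) {n p : ℕ} (hp : 0 < p) (m : ℕ)
    (hx0 : C.a0 * (p : ℤ) < (C.b0 : ℤ) * ((n : ℤ) - m * p)) (hx1 : (C.b1 : ℤ) * ((n : ℤ) - m * p) < C.a1 * (p : ℤ))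
    (i : ℕ) : C.c ≤ nuPair (bC5 n) i p := by
  have hb : 0 < C.b0 ∧ 0 < C.b1 := by
    have h := hcheck
    simp only [Cell.check, Bool.and_eq_true, decide_eq_true_eq] at h; exact ⟨h.1.1.1, h.1.1.2⟩
  have hp' : (0 : ℚ) < p := by exact_mod_cast hp
  have hb0 : (0 : ℚ) < C.b0 := by exact_mod_cast hb.1
  have hb1 : (0 : ℚ) < C.b1 := by exact_mod_cast hb.2
  rw [nuPair_bC5_eq_fract n i p m]
  have hx : (n : ℚ) / p - ((m : ℕ) : ℤ) = ((((n : ℤ) - m * p : ℤ)) : ℚ) / (p : ℚ) := by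
    have hp0 : (p : ℚ) ≠ 0 := hp'.ne'
    push_cast
    field_simp
  rw [hx]
  refine Cell.check_sound hcheck ?_ ?_ (Int.fract_nonneg _) (Int.fract_lt_one _)
  · rw [div_lt_div_iff₀ hb0 hp']
    have h0 : C.a0 * (p : ℤ) < ((n : ℤ) - m * p) * (C.b0 : ℤ) := by linarith
    exact_mod_cast h0
  · rw [div_lt_div_iff₀ hp' hb1]
    have h1 : ((n : ℤ) - m * p) * (C.b1 : ℤ) < C.a1 * (p : ℤ) := by linarith
    exact_mod_cast h1

/-! ### The partner's exponent -/

/-- `⌊(z−1)/p⌋ ≤ ⌊z/p⌋`. -/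
private theorem pred_ediv_le' (z : ℤ) {p : ℤ} (hp : 0 < p) : (z - 1) / p ≤ z / p :=
  Int.ediv_le_ediv hp (by omega)

/-- `⌊z/p⌋ ≤ ⌊(z−1)/p⌋` when `p ∤ z`. -/
private theorem ediv_le_pred_ediv' {z : ℤ} {p : ℤ} (hp : 0 < p) (h : ¬ p ∣ z) : z / p ≤ (z - 1) / p := by
  have h1 := Int.emod_add_ediv_mul z p
  have h2 : z % p ≠ 0 := fun h0 => h (Int.dvd_of_emod_eq_zero h0)
  have h3 : 0 ≤ z % p := Int.emod_nonneg z hp.ne'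
  have h4 : 1 ≤ z % p := by omega
  exact Int.le_ediv_of_mul_le hp (by linarith)

/-- **`ν(b; i, p) ≤ ν(b′; i, p)`** for `p ∤ 18n`, `p ∤ 20n` (the partner raises slot 7 by one: only the two pair blocks through
slot 7 and their `i`-dependent companions change, each by a difference of consecutive floors). -/
theorem nuPair_bC5'_ge {n p : ℕ} (hp : 0 < p) (h13 : ¬ (p : ℤ) ∣ 18 * n) (h14 : ¬ (p : ℤ) ∣ 20 * n) (i : ℕ) :
    nuPair (bC5 n) i p ≤ nuPair (bC5' n) i p := by
  have hp' : (0 : ℤ) < p := by exact_mod_cast hp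
  obtain ⟨h0, h1, h2, h3, h4, h5, h6, h7⟩ := bn_bC5_all n
  obtain ⟨g0, g1, g2, g3, g4, g5, g6, g7⟩ := bn_bC5'_all n
  -- the four floors that change
  have f1 : (18 * (n : ℤ)) / p ≤ (18 * (n : ℤ) - 1) / p := ediv_le_pred_ediv' hp' h13
  have f2 : ((i : ℤ) - 12 * n - 1) / p ≤ ((i : ℤ) - 12 * n) / p := pred_ediv_le' _ hp'
  have f3 : (20 * (n : ℤ)) / p ≤ (20 * (n : ℤ) - 1) / p := ediv_le_pred_ediv' hp' h14
  have f4 : (39 * (n : ℤ) - i - 1) / p ≤ (39 * (n : ℤ) - i) / p := pred_ediv_le' _ hp'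
  unfold nuPair
  simp only [sum_range_succ, sum_range_zero, pfst, psnd, h0, h1, h2, h3, h4, h5, h6, h7, g0, g1, g2, g3, g4, g5,
    g6, g7]
  push_cast
  ring_nf at f1 f2 f3 f4 ⊢
  linarith

end Summit.KontsevichZagierPeriods.Zeta5Search.RayC5
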